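import Summits.CriticalPhenomena.PercolationContinuityZ3.Theorems.SahiMasterFamilyGluedFramesPure

/-!
# Glued frames, IV: deletion faces at core-free coordinates

Unit `prim-master-conj` (crux anchor stmt-CriticalPhenomena-4575), gen 11; memo HOME/prim-master-conj/TIGHTNESS-III.md §1.3, §2.1, §2.3.
Continues `SahiMasterFamilyGluedFrames{,Safe,Pure}`.  A coordinate `f` is CORE-FREE for the family `U` on `W` if `univ ∖ {f}` lies in every
member (`CoreFree`); then the DELETION face `k ↦ (U k)^{f ← false}` (`faceF`) has non-empty members.  If the contraction faces are structured:
* **`mem_cframe_faceF_iff`** (TIGHTNESS-III Lemma 1.3, main part): when the deletion face at a core-free `f` is structured, its canonical frames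
  agree with the `f ← false` sections of the glued frames at every configuration containing a coordinate other than `f` (the two double faces
  `(f←0, h←1)` coincide; `cframe_secAt` twice);
* `FaceFConsistent` — the full statement "frames of the deletion face = sections of the glued frames" (the bottom point included), taken as a
  hypothesis below; the memo derives it at order four from "no absorbing member";
* **`two_le_card_gfail_of_faceF`** — (F2) at configurations avoiding `f`, in particular at the bottom point;
* **`forall_mem_of_pure_in_faceF`**, **`mem_esupp_of_pure_in_faceF`** (TIGHTNESS-III 2.3, OWNERS): a globally non-pure member which is pure in
  the deletion face at `f` has all its glued-annihilator points containing `f`, hence `f` in the essential support of its glued frame; so two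
  distinct such members cannot exist when the glued supports are disjoint (`owner_unique`);
* `mem_verts_gframe_of_coreFree` — a core-free coordinate in the support of a glued frame is a vertex of it (TIGHTNESS-III 1.4).
Pure combinatorics; axioms standard. [this work]
-/

noncomputable section

open scoped Classical

namespace Summit.CriticalPhenomena.PercolationContinuityZ3.Theorems

namespace GluedFrames

open Finset Function
open Literature.Probability.LatticeModels.Kahn2022 (Affects)

variable {ι : Type*} [Fintype ι] {κ : Type*} (U : κ → Set (Set ι)) (W : Finset κ)

/-! ### Deletion faces and core-free coordinates -/

/-- The deletion face at `f`: `k ↦ (U k)^{f ← false}`. [this work] -/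
def faceF (f : ι) : κ → Set (Set ι) := fun k => secAt f false (U k)

omit [Fintype ι] in
/-- Unfolding `faceF`. [this work] -/
@[simp] theorem faceF_apply (f : ι) (k : κ) : faceF U f k = secAt f false (U k) := rfl

omit [Fintype ι] in
/-- Deletion faces of increasing events are increasing. [folklore] -/
theorem isUpperSet_faceF (hU : ∀ k, IsUpperSet (U k)) (f : ι) : ∀ k, IsUpperSet (faceF U f k) :=
  fun k => isUpperSet_secAt f false (hU k)

/-- **Core-free coordinate** (for the whole index type): `univ ∖ {f}` lies in every member, i.e. `f` lies in no member's core. [this work] -/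
def CoreFree (f : ι) : Prop := ∀ k, Set.univ \ {f} ∈ U k

omit [Fintype ι] in
/-- At a core-free coordinate the deletion face has non-empty members. [this work] -/
theorem faceF_nonempty {f : ι} (hf : CoreFree U f) : ∀ k, (faceF U f k).Nonempty := by
  intro k
  refine ⟨Set.univ, ?_⟩
  rw [faceF_apply, mem_secAt]
  simpa only [forceAt, cond_false] using hf k

omit [Fintype ι] in
/-- At a core-free coordinate the double face `(f ← false, h ← true)` has non-empty members. [this work] -/
theorem secAt_true_faceF_nonempty (hU : ∀ k, IsUpperSet (U k)) {f : ι} (hf : CoreFree U f) (h : ι) :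
    ∀ k, (secAt h true (faceF U f k)).Nonempty :=
  faceT_nonempty (faceF U f) (isUpperSet_faceF U hU f) (faceF_nonempty U hf) h

omit [Fintype ι] in
/-- At a core-free coordinate `f`, the double face `(h ← true, f ← false)` has non-empty members (`h ≠ f`). [this work] -/
theorem secAt_false_faceT_nonempty {f : ι} (hf : CoreFree U f) {h : ι} (hhf : h ≠ f) :
    ∀ k, (secAt f false (faceT U h k)).Nonempty := by
  intro k
  refine ⟨Set.univ \ {f}, ?_⟩
  rw [mem_secAt_false_iff_of_notMem (fun hc => hc.2 rfl), faceT_apply, mem_secAt]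
  simp only [forceAt, cond_true]
  have : insert h (Set.univ \ {f}) = Set.univ \ {f} :=
    Set.insert_eq_of_mem ⟨Set.mem_univ h, fun e => hhf e⟩
  rw [this]; exact hf k

/-! ### Lemma 1.3: frames of the deletion face are sections of the glued frames (off the bottom point) -/

/-- **TIGHTNESS-III Lemma 1.3 (main part).**  If the contraction faces are structured and the deletion face at the core-free coordinate `f` is
structured, then at every configuration containing some `h ≠ f` the canonical frame of the deletion face agrees with the `f ← false` section of
the glued frame. [this work] -/
theorem mem_cframe_faceF_iff (hU : ∀ k, IsUpperSet (U k)) (hne : ∀ k, (U k).Nonempty) (hS : ∀ h, Structured (faceT U h) W)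
    {f : ι} (hf : CoreFree U f) (hF : Structured (faceF U f) W) {w : κ} (hw : w ∈ W) {ω : Set ι} {h : ι} (hhω : h ∈ ω)
    (hhf : h ≠ f) : ω ∈ cframe (faceF U f) W w ↔ ω ∈ secAt f false (gframe U W w) := by
  -- the two double faces coincide
  have hfam : (fun k => secAt h true (faceF U f k)) = fun k => secAt f false (faceT U h k) := by
    funext k; simp only [faceF_apply, faceT_apply]; exact secAt_comm hhf true false
  have e1 := cframe_secAt (faceF U f) h true (isUpperSet_faceF U hU f) (secAt_true_faceF_nonempty U hU hf h) hF hw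
  have e2 := cframe_secAt (faceT U h) f false (isUpperSet_faceT U hU h) (secAt_false_faceT_nonempty U hf hhf) (hS h) hw
  rw [hfam] at e1
  -- `secAt h true (cframe (faceF f)) = secAt f false (cframe (faceT h)) = secAt f false (secAt h true gframe)`
  have e3 : secAt h true (cframe (faceF U f) W w) = secAt f false (secAt h true (gframe U W w)) := by
    rw [← e1, e2, secAt_true_gframe U W hU hne hS hw h]
  have key : ω ∈ secAt h true (cframe (faceF U f) W w) ↔ ω ∈ secAt f false (secAt h true (gframe U W w)) := by rw [e3]
  rw [mem_secAt_true_iff_of_mem hhω, secAt_comm (Ne.symm hhf) false true, mem_secAt_true_iff_of_mem hhω] at key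
  exact key

/-- **Full consistency of a deletion face** (frames = sections, bottom point included) — the form in which TIGHTNESS-III uses Lemma 1.3. [this work] -/
def FaceFConsistent (f : ι) : Prop := ∀ w ∈ W, cframe (faceF U f) W w = secAt f false (gframe U W w)

/-- Under full consistency, the canonical annihilator of the deletion face is the section of the glued annihilator. [this work] -/
theorem cframe_faceF_diff (f : ι) (hc : FaceFConsistent U W f) {w : κ} (hw : w ∈ W) :
    cframe (faceF U f) W w \ faceF U f w = secAt f false (gann U W w) := by
  rw [hc w hw, faceF_apply, gann, secAt_diff]

/-! ### (F2) through a deletion face -/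

/-- **(F2) at configurations avoiding `f`**: if the deletion face at `f` is structured and consistent, a configuration `χ ∌ f` of the glued
annihilator of `w` fails the glued frames of at least two other members — in particular the BOTTOM point does. [this work] -/
theorem two_le_card_gfail_of_faceF (hU : ∀ k, IsUpperSet (U k)) {f : ι} (hf : CoreFree U f) (hF : Structured (faceF U f) W)
    (hc : FaceFConsistent U W f) {w : κ} (hw : w ∈ W) {χ : Set ι} (hχ : χ ∈ gann U W w) (hfχ : f ∉ χ) :
    2 ≤ ((W.erase w).filter fun j => χ ∉ gframe U W j).card := by
  have hΦU := isUpperSet_faceF U hU f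
  have hΦne := faceF_nonempty U hf
  have hχA : χ ∈ cframe (faceF U f) W w := by rw [hc w hw, mem_secAt_false_iff_of_notMem hfχ]; exact hχ.1
  have hχU : χ ∉ faceF U f w := by rw [faceF_apply, mem_secAt_false_iff_of_notMem hfχ]; exact hχ.2
  refine (two_le_card_cfail_of_annihilator (faceF U f) hΦU hΦne hF hw hχA hχU).trans (card_le_card fun j hj => ?_)
  rw [mem_filter] at hj ⊢
  refine ⟨hj.1, fun hg => hj.2 ?_⟩
  rw [hc j (mem_of_mem_erase hj.1), mem_secAt_false_iff_of_notMem hfχ]; exact hg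

/-- **Antipodality through a deletion face**: cross annihilator points (as in `false_of_cross_gann`) cannot both avoid a core-free `f` whose
deletion face is structured and consistent. [this work] -/
theorem false_of_cross_gann_faceF (hU : ∀ k, IsUpperSet (U k)) {f : ι} (hf : CoreFree U f) (hF : Structured (faceF U f) W)
    (hc : FaceFConsistent U W f) {v w p q : κ} (hv : v ∈ W) (hw : w ∈ W) {χ ψ : Set ι} (hχ : χ ∈ gann U W v) (hψ : ψ ∈ gann U W w)
    (hχQ : ∀ u ∈ W, χ ∉ gframe U W u → u = p ∨ u = w) (hψQ : ∀ u ∈ W, ψ ∉ gframe U W u → u = q ∨ u = v)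
    (hfχ : f ∉ χ) (hfψ : f ∉ ψ) : False := by
  have hΦU := isUpperSet_faceF U hU f
  have hΦne := faceF_nonempty U hf
  have hA : ∀ {x : κ} {ω : Set ι}, x ∈ W → f ∉ ω → (ω ∈ cframe (faceF U f) W x ↔ ω ∈ gframe U W x) := by
    intro x ω hx hfω; rw [hc x hx, mem_secAt_false_iff_of_notMem hfω]
  have hM : ∀ {x : κ} {ω : Set ι}, f ∉ ω → (ω ∈ faceF U f x ↔ ω ∈ U x) := by
    intro x ω hfω; rw [faceF_apply, mem_secAt_false_iff_of_notMem hfω]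
  exact false_of_cross_annihilators_cframe (faceF U f) hΦU hΦne hF hv hw
    ((hA hv hfχ).2 hχ.1) (fun h => hχ.2 ((hM hfχ).1 h))
    (fun u hu hcu => hχQ u hu fun hg => hcu ((hA hu hfχ).2 hg))
    ((hA hw hfψ).2 hψ.1) (fun h => hψ.2 ((hM hfψ).1 h))
    (fun u hu hcu => hψQ u hu fun hg => hcu ((hA hu hfψ).2 hg))

/-! ### Owners of core-free coordinates -/

/-- **A member pure in the deletion face at `f` has all its glued-annihilator points containing `f`.** [this work] -/
theorem forall_mem_of_pure_in_faceF {f : ι} (hc : FaceFConsistent U W f) {x : κ} (hx : x ∈ W)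
    (hpure : cframe (faceF U f) W x ⊆ faceF U f x) {χ : Set ι} (hχ : χ ∈ gann U W x) : f ∈ χ := by
  by_contra hfχ
  have h1 : χ ∈ cframe (faceF U f) W x := by rw [hc x hx, mem_secAt_false_iff_of_notMem hfχ]; exact hχ.1
  have h2 := hpure h1
  rw [faceF_apply, mem_secAt_false_iff_of_notMem hfχ] at h2
  exact hχ.2 h2

/-- **Owners**: a globally NON-pure member which is pure in the (consistent) deletion face at `f` has `f` in the essential support of its glued
frame. [this work] -/
theorem mem_esupp_of_pure_in_faceF (hU : ∀ k, IsUpperSet (U k)) {f : ι} (hc : FaceFConsistent U W f) {x : κ} (hx : x ∈ W)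
    (hpure : cframe (faceF U f) W x ⊆ faceF U f x) (hN : (gann U W x).Nonempty) : f ∈ esupp (gframe U W x) := by
  obtain ⟨μ, hμ, -, hμS⟩ := exists_minimal_gann U hU W hN
  exact mem_coe.1 (hμS (forall_mem_of_pure_in_faceF U W hc hx hpure hμ))

/-- **At most one globally non-pure member is pure in a given consistent deletion face** (when the glued supports are pairwise disjoint).
[this work] -/
theorem owner_unique (hU : ∀ k, IsUpperSet (U k)) {f : ι} (hc : FaceFConsistent U W f)
    (hd : ∀ w ∈ W, ∀ w' ∈ W, w ≠ w' → Disjoint (esupp (gframe U W w)) (esupp (gframe U W w')))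
    {x y : κ} (hx : x ∈ W) (hy : y ∈ W) (hpx : cframe (faceF U f) W x ⊆ faceF U f x) (hpy : cframe (faceF U f) W y ⊆ faceF U f y)
    (hNx : (gann U W x).Nonempty) (hNy : (gann U W y).Nonempty) : x = y := by
  by_contra hxy
  exact Finset.disjoint_left.1 (hd x hx y hy hxy) (mem_esupp_of_pure_in_faceF U W hU hc hx hpx hNx)
    (mem_esupp_of_pure_in_faceF U W hU hc hy hpy hNy)

/-- A globally pure member is pure in every deletion face (consistent case). [this work] -/
theorem pure_in_faceF_of_pure {f : ι} (hc : FaceFConsistent U W f) {x : κ} (hx : x ∈ W) (hpure : gann U W x = ∅) :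
    cframe (faceF U f) W x ⊆ faceF U f x := by
  intro ω hω
  rw [hc x hx, mem_secAt] at hω
  rw [faceF_apply, mem_secAt]
  by_contra hωU
  have : forceAt f false ω ∈ gann U W x := ⟨hω, hωU⟩
  rw [hpure] at this
  exact this

/-! ### Core-free coordinates inside a block are vertices -/

/-- **A core-free coordinate in the essential support of a glued frame is a vertex of that frame** (`univ ∖ {f}` lies in it). [this work] -/
theorem mem_verts_gframe_of_coreFree (hU : ∀ k, IsUpperSet (U k)) {f : ι} (hf : CoreFree U f) {w : κ}
    (hfw : f ∈ esupp (gframe U W w)) : f ∈ verts (gframe U W w) :=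
  mem_verts.2 ⟨hfw, subset_gframe U W hU w (hf w)⟩

/-- Conversely, under the product formula a vertex of a glued frame (with pairwise disjoint glued supports and at least two coordinates) is
core-free: `univ ∖ {f}` lies in every member. [this work] -/
theorem coreFree_of_mem_verts (hU : ∀ k, IsUpperSet (U k)) (hne : ∀ k, (U k).Nonempty) (hS : ∀ h, Structured (faceT U h) W)
    (hd : ∀ w ∈ W, ∀ w' ∈ W, w ≠ w' → Disjoint (esupp (gframe U W w)) (esupp (gframe U W w')))
    (hWU : ∀ k, k ∈ W) (h2 : ∀ f : ι, ∃ h', h' ≠ f) {w : κ} (hw : w ∈ W) {f : ι} (hfw : f ∈ verts (gframe U W w)) :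
    CoreFree U f := by
  intro k
  obtain ⟨h', hh'⟩ := h2 f
  have hfS := (mem_verts.1 hfw).1
  refine mem_of_forall_mem_gframe U W hU hne hS (ω := Set.univ \ {f}) ⟨h', Set.mem_univ h', fun e => hh' e⟩ (fun j hj => ?_)
    (hWU k)
  by_cases hjw : j = w
  · subst hjw; exact (mem_verts.1 hfw).2
  · -- `gframe j` does not read `f`
    have hfj : ¬ Affects (gframe U W j) f := fun ha =>
      Finset.disjoint_left.1 (hd w hw j hj (Ne.symm hjw)) hfS (mem_esupp.2 ha)
    have huniv : Set.univ ∈ gframe U W j :=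
      univ_mem_of_nonempty (isUpperSet_gframe U W hU j) ⟨_, subset_gframe U W hU j (univ_mem_of_nonempty (hU j) (hne j))⟩
    refine (insert_mem_iff_of_not_affects (isUpperSet_gframe U W hU j) hfj (Set.univ \ {f})).1 ?_
    rwa [Set.insert_sdiff_singleton, Set.insert_eq_of_mem (Set.mem_univ f)]

end GluedFrames

end Summit.CriticalPhenomena.PercolationContinuityZ3.Theorems
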